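import Summits.Ventures.CertifiedManyBodySolver.Rows.MPSNodeTwins
import Mathlib.Algebra.Order.BigOperators.Ring.Finset

/-!
# Integer twins for the `relax = mps(N, D, A)` side conditions, LARGE-`N` form:
# Frobenius submultiplicativity and a-priori bounds from a DOUBLING TABLE of powers (`O(log N)` kernel products instead of `N`)

HONEST FRAMING: first certified bounds; not a superconductivity verdict; every number certified or labelled float.

WHAT THIS FILE IS (programme hubbard-alg, LIT team lit-1 gen-13; companion of LD1′ for D6-size instances). The cells BY NAME of
the `mps` nodes (`MPSChainKSDNNode[Srot].ltiChainKSDNNode`, `MPSSpinChainNode.energyDensity_ge`) take the a-priori-bound side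
condition `∀ k, k + 4 ≤ N → 0 ≤ B (k+4) ∧ frobSqQ (transferOpQ A ^ (k+2)) ≤ B (k+4)²` (FORMAT-ltisdp §4.7). `Rows/MPSNodeTwins.lean`
discharges it by the kernel from a table of STAGED powers `P (j+1) = P j · Tz` — `N − 2` products of `D² × D²` integer matrices,
fine at lane-B sizes (`N ≤ 16`, `D ≤ 8`) but linear in `N` at the L3-D6 sizes (`N = 40`, `D = 12`: 38 products of `144 × 144`
big-integer matrices). This file proves the SUBMULTIPLICATIVITY of the exact sum of squares, `frobSqZ (M · N) ≤ frobSqZ M · frobSqZ N`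
(Cauchy–Schwarz), hence `frobSqZ (T^(Σ eᵢ)) ≤ Π frobSqZ (T^eᵢ)`, and assembles the side condition from a DOUBLING table
`Q 0 = Tz`, `Q (i+1) = Q i · Q i` (so `Q i = Tz^(2^i)`; `⌈log₂ N⌉` products) plus, for each `m`, a list of table indices whose powers
of two sum to `m − 2` and ONE rational inequality `Π_i frobSqZ (Q i) ≤ (B m)² · 2^(4 a (m−2))` — every item a `decide` on literal
integers. The price is slack: `Π ‖T^{2^i}‖_F²` over the binary digits instead of `‖T^{m−2}‖_F²` (for a near-isometric MPS both are
`O(D)`-ish per factor), paid in the SDP's a-priori bounds `B m`, which the generator chooses. Definitions with bodies only; no `sorry`,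
no new axiom, no named fact. [cite: KullEtAl2024, §2.5]
-/

namespace Summit.Ventures.CertifiedManyBodySolver

open Matrix
open scoped BigOperators

/-! ## §A  Cauchy–Schwarz: the exact sum of squares is submultiplicative -/

section Frobenius

variable {l m n : Type*} [Fintype l] [Fintype m] [Fintype n]

/-- `frobSqZ M ≥ 0`. [folklore] -/
theorem frobSqZ_nonneg (M : Matrix l m ℤ) : 0 ≤ frobSqZ M :=
  Finset.sum_nonneg fun _ _ => Finset.sum_nonneg fun _ _ => sq_nonneg _

/-- **Submultiplicativity** `‖M N‖_F² ≤ ‖M‖_F² ‖N‖_F²` for integer matrices (Cauchy–Schwarz on each entry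
`(MN)_{ik} = Σ_j M_{ij} N_{jk}`). [folklore] -/
theorem frobSqZ_mul_le (M : Matrix l m ℤ) (N : Matrix m n ℤ) : frobSqZ (M * N) ≤ frobSqZ M * frobSqZ N := by
  unfold frobSqZ
  calc ∑ i, ∑ k, (M * N) i k ^ 2 ≤ ∑ i, ∑ k, (∑ j, M i j ^ 2) * (∑ j, N j k ^ 2) := by
        refine Finset.sum_le_sum fun i _ => Finset.sum_le_sum fun k _ => ?_
        rw [Matrix.mul_apply]
        exact Finset.sum_mul_sq_le_sq_mul_sq Finset.univ (fun j => M i j) (fun j => N j k)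
    _ = (∑ i, ∑ j, M i j ^ 2) * ∑ k, ∑ j, N j k ^ 2 := by rw [Finset.sum_mul_sum]
    _ = (∑ i, ∑ j, M i j ^ 2) * ∑ j, ∑ k, N j k ^ 2 := by
        congr 1
        exact Finset.sum_comm

/-- Powers: `‖T^(i+j)‖_F² ≤ ‖T^i‖_F² · ‖T^j‖_F²`. [folklore] -/
theorem frobSqZ_pow_add_le {m : Type*} [Fintype m] [DecidableEq m] (T : Matrix m m ℤ) (i j : ℕ) :
    frobSqZ (T ^ (i + j)) ≤ frobSqZ (T ^ i) * frobSqZ (T ^ j) := by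
  rw [pow_add]
  exact frobSqZ_mul_le _ _

/-- **A product of exponents**: `‖T^(e + Σ es)‖_F² ≤ ‖T^e‖_F² · Π_{e' ∈ es} ‖T^e'‖_F²` for any list of exponents. [folklore] -/
theorem frobSqZ_pow_sum_le {m : Type*} [Fintype m] [DecidableEq m] (T : Matrix m m ℤ) (e : ℕ) (es : List ℕ) :
    frobSqZ (T ^ (e + es.sum)) ≤ frobSqZ (T ^ e) * (es.map fun e' => frobSqZ (T ^ e')).prod := by
  induction es generalizing e with
  | nil => simp
  | cons e' es ih =>
    rw [List.sum_cons, List.map_cons, List.prod_cons, ← add_assoc, ← mul_assoc]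
    refine (ih (e + e')).trans (mul_le_mul_of_nonneg_right (frobSqZ_pow_add_le T e e') ?_)
    exact List.prod_nonneg fun x hx => by
      obtain ⟨e'', _, rfl⟩ := List.mem_map.1 hx
      exact frobSqZ_nonneg _

end Frobenius

/-! ## §B  The doubling table `Q i = Tz^(2^i)` and the assembled side condition -/

section Doubling

variable {m : Type*} [Fintype m] [DecidableEq m]

/-- **Powers of two from a doubling table checked one product at a time**: if `Q 0 = T` and `Q (j+1) = Q j · Q j` for `j < i`,
then `T ^ (2^i) = Q i` (each step is a decidable equality of integer matrices). [folklore] -/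
theorem pow_two_pow_eq_of_doubling (T : Matrix m m ℤ) (Q : ℕ → Matrix m m ℤ) (i : ℕ) (h0 : Q 0 = T)
    (hs : ∀ j, j < i → Q (j + 1) = Q j * Q j) : T ^ (2 ^ i) = Q i := by
  induction i with
  | zero => rw [pow_zero, pow_one, h0]
  | succ i ih =>
    rw [pow_succ, pow_mul, ih fun j hj => hs j (Nat.lt_succ_of_lt hj), sq, hs i (Nat.lt_succ_self i)]

/-- **Binary decomposition bound**: for a nonempty list of table indices `is` (all `≤ L`, the table checked up to `L`),
`‖T^(Σ_{i ∈ is} 2^i)‖_F² ≤ Π_{i ∈ is} ‖Q i‖_F²`. [folklore] -/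
theorem frobSqZ_pow_le_prod_of_doubling (T : Matrix m m ℤ) (Q : ℕ → Matrix m m ℤ) (L : ℕ) (h0 : Q 0 = T)
    (hs : ∀ j, j < L → Q (j + 1) = Q j * Q j) (is : List ℕ) (his : ∀ i ∈ is, i ≤ L) (hne : is ≠ []) :
    frobSqZ (T ^ (is.map (2 ^ ·)).sum) ≤ (is.map fun i => frobSqZ (Q i)).prod := by
  obtain ⟨i₀, is', rfl⟩ := List.exists_cons_of_ne_nil hne
  have hQ : ∀ i ∈ i₀ :: is', frobSqZ (Q i) = frobSqZ (T ^ (2 ^ i)) := fun i hi => by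
    rw [pow_two_pow_eq_of_doubling T Q i h0 fun j hj => hs j (lt_of_lt_of_le hj (his i hi))]
  have hmap : (is'.map fun i => frobSqZ (Q i)) = (is'.map (2 ^ ·)).map fun e => frobSqZ (T ^ e) := by
    rw [List.map_map]
    exact List.map_congr_left fun i hi => by
      simp only [Function.comp_apply]
      exact hQ i (List.mem_cons_of_mem _ hi)
  rw [List.map_cons, List.sum_cons, List.map_cons, List.prod_cons, hQ i₀ (by simp), hmap]
  exact frobSqZ_pow_sum_le T (2 ^ i₀) (is'.map (2 ^ ·))

variable {q D : ℕ}

/-- **The a-priori-bound side condition of the `mps` cells from a DOUBLING table** (large-`N` form of `mpsBounds_of_twin`). Data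
supplied by the instance, every item a `decide` on literal integers: the doubling table `Q` of `Tz = transferOpZ Az` up to `L`
(`Q 0 = Tz`, `Q (j+1) = Q j · Q j` for `j < L` — `L ≈ log₂ N` products); for each `m = k + 4 ≤ N` a nonempty list `idx k` of table
indices `≤ L` with `Σ_{i ∈ idx k} 2^i = m − 2` (the binary digits of `m − 2`); and the rational inequalities `0 ≤ B m`,
`Π_{i ∈ idx k} ‖Q i‖_F² ≤ (B m)² · 2^(4 a (m−2))`. Conclusion: the hypothesis
`∀ k, k + 4 ≤ N → 0 ≤ B (k+4) ∧ frobSqQ (transferOpQ (Az/2^a) ^ (k+2)) ≤ B (k+4)²` of `MPSChainKSDNNode[Srot].ltiChainKSDNNode` /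
`MPSSpinChainNode.energyDensity_ge`. [cite: KullEtAl2024, §2.5] -/
theorem mpsBounds_of_doubling (Az : Fin q → Matrix (Fin D) (Fin D) ℤ) (a N L : ℕ) (B : ℕ → ℚ)
    (Q : ℕ → Matrix (Fin D × Fin D) (Fin D × Fin D) ℤ) (h0 : Q 0 = transferOpZ Az)
    (hs : ∀ j, j < L → Q (j + 1) = Q j * Q j) (idx : ℕ → List ℕ)
    (hidx : ∀ k, k + 4 ≤ N → idx k ≠ [] ∧ (∀ i ∈ idx k, i ≤ L) ∧ ((idx k).map (2 ^ ·)).sum = k + 2)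
    (hB : ∀ k, k + 4 ≤ N → 0 ≤ B (k + 4) ∧
      ((((idx k).map fun i => frobSqZ (Q i)).prod : ℤ) : ℚ) ≤ B (k + 4) ^ 2 * 2 ^ (4 * a * (k + 2))) :
    ∀ k, k + 4 ≤ N → 0 ≤ B (k + 4) ∧ frobSqQ (transferOpQ (dyadicTensorQ Az a) ^ (k + 2)) ≤ B (k + 4) ^ 2 := by
  intro k hk
  obtain ⟨hne, hL, hsum⟩ := hidx k hk
  refine ⟨(hB k hk).1, ?_⟩
  rw [frobSqQ_transferOpQ_dyadicTensorQ_pow, div_le_iff₀ (by positivity)]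
  have hint : frobSqZ (transferOpZ Az ^ (k + 2)) ≤ ((idx k).map fun i => frobSqZ (Q i)).prod := by
    rw [← hsum]
    exact frobSqZ_pow_le_prod_of_doubling _ Q L h0 hs (idx k) hL hne
  exact le_trans (by exact_mod_cast hint) (hB k hk).2

end Doubling

end Summit.Ventures.CertifiedManyBodySolver
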